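import Literature.Barriers.FinalStateConjecture.TrappingDerivativeLossGeodesicBeamsHamiltonian
import Literature.Geometry.Lorentzian.GaussianBeamData
import Literature.Analysis.Calculus.StrictMonoInverse
import HarnessLib

/-!
# Gaussian beams along a null geodesic of Kerr, III: the beam data in Kerr–Schild time
(third proof file towards `KerrNullGeodesicGaussianBeams_holds`,
`Literature/Barriers/FinalStateConjecture/TrappingDerivativeLossGeodesicBeams.lean`; family `gr`,
summit `FinalStateConjecture`; namespace `Literature.Barriers.FinalStateConjecture.GaussianBeam`)

Sbierski's construction (Anal. PDE 8 (2015), §3 = arXiv:1311.2477 §2.2) is carried out along the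
affine parameter `s` of the null geodesic `γ`; the energy characterisation of §4 reads the beam on
the leaves `Σ_τ = {t* = τ}` through the points `γ_τ = Im γ ∩ Σ_τ`. For a future-directed `γ`
(`γ̇⁰ > 0`) the Kerr–Schild time `t = γ⁰(s)` is a diffeomorphism onto an open interval `J`, and the
data of the beam become functions of `t`: this file packages the geodesic `γ` (file I,
`…GeodesicBeamsChart`), its momentum `p = γ̇♭`, Hamilton's equations and the phase Hessian
`M(s)` (file II, `…GeodesicBeamsHamiltonian`) into the structure
`Literature.Geometry.Lorentzian.GaussianBeam.BeamData` of `GaussianBeamData.lean` (coefficients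
`G = (g^{μν})` = `Kerr.inverseMetric`, domain `V` = the exterior chart, curve
`X(t) = γ(σ(t)) = (t, c(t))`, `κ(t) = γ̇⁰(σ(t))`, `P(t) = p(σ(t))`, `M(t) = M(σ(t))`), verifying
its fourteen identities by the chain rule `d/dt = κ⁻¹ d/ds`:

* `KerrNullGeodesic` — a future-directed null geodesic of the Kerr exterior with `γ⁰(0) = 0`
  (the hypotheses of `KerrNullGeodesicGaussianBeams`);
* `KerrNullGeodesic.σ`, `J`, `c`, `κ`, `P`, `Mm` and **`KerrNullGeodesic.beamData`**.

Everything is proved; no named facts are introduced.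

## References

* J. Sbierski, Anal. PDE 8 (2015) 1379–1420 (arXiv:1311.2477), §2.2 of the arXiv text,
  (2.14)–(2.27), and §2.3 (the leaves `Σ_τ`) (key `Sbierski2015`).
-/

noncomputable section

open Bundle Set Filter Function
open scoped Manifold ContDiff Topology Matrix

namespace Literature.Barriers.FinalStateConjecture

namespace GaussianBeam

open Literature.Geometry.Lorentzian Literature.Geometry.Lorentzian.GaussianBeam
  Literature.Analysis.Calculus

variable [Kerr.Facts] [Kerr.SliceFacts]

/-- **A future-directed null geodesic of the Kerr exterior through `{t* = 0}` at parameter `0`**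
(the curve of `KerrNullGeodesicGaussianBeams`: geodesic of `Kerr.smoothMetric`, null velocity,
`γ̇⁰ > 0`, `γ⁰(0) = 0`). [cite: Sbierski2015, §4 (the theorem: `γ` null, `N`-energy `−g(N, γ̇)`)] -/
structure KerrNullGeodesic (M a : ℝ) where
  /-- the geodesic -/
  γ : ℝ → Kerr.exterior M a
  geod : IsGeodesic (Kerr.smoothMetric M a (Kerr.rPlus M a)).leviCivita γ
  null : ∀ s, (Kerr.smoothMetric M a (Kerr.rPlus M a)).IsNull (velocity 𝓘(ℝ, E4) γ s)
  time_pos : ∀ s, 0 < vel γ s 0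
  time_zero : (γ 0 : E4) 0 = 0

namespace KerrNullGeodesic

variable {M a : ℝ} (Γ : KerrNullGeodesic M a)

/-! ### The Kerr–Schild time along `γ` and its inverse -/

/-- The Kerr–Schild time along the geodesic, `t(s) = γ⁰(s)`. [cite: Sbierski2015, §4 (the leaves `Σ_τ`)] -/
def tfun (s : ℝ) : ℝ := (Γ.γ s : E4) 0

/-- `ṫ(s) = γ̇⁰(s)`. [folklore] -/
theorem hasDerivAt_tfun (s : ℝ) : HasDerivAt Γ.tfun (vel Γ.γ s 0) s :=
  (EuclideanSpace.proj (𝕜 := ℝ) (0 : Fin 4)).hasFDerivAt.comp_hasDerivAt s (hasDerivAt_pos Γ.geod s)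

/-- `t(s)` is `C^∞`. [folklore] -/
theorem contDiff_tfun : ContDiff ℝ ∞ Γ.tfun := contDiff_euclidean.1 (contDiff_pos Γ.geod) 0

/-- `deriv t = γ̇⁰ > 0`. [folklore] -/
theorem deriv_tfun_pos (s : ℝ) : 0 < deriv Γ.tfun s := by
  rw [(Γ.hasDerivAt_tfun s).deriv]; exact Γ.time_pos s

/-- `t(0) = 0`. [folklore] -/
theorem tfun_zero : Γ.tfun 0 = 0 := Γ.time_zero

/-- **The parameter as a function of Kerr–Schild time**, `σ = t⁻¹` (on the range of `t`).
[cite: Sbierski2015, §4 (the points `γ_τ = Im γ ∩ Σ_τ`)] -/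
def σ : ℝ → ℝ := invFun Γ.tfun

/-- **The time interval swept by the geodesic**, `J = t(ℝ)`. [cite: Sbierski2015, §4] -/
def J : Set ℝ := range Γ.tfun

/-- `J` is open. [folklore] -/
theorem isOpen_J : IsOpen Γ.J := StrictMonoInverse.isOpen_range Γ.hasDerivAt_tfun Γ.time_pos

/-- `J` is an interval. [folklore] -/
theorem ordConnected_J : Γ.J.OrdConnected :=
  (isPreconnected_range Γ.contDiff_tfun.continuous).ordConnected

/-- `0 ∈ J`. [folklore] -/
theorem zero_mem_J : (0 : ℝ) ∈ Γ.J := ⟨0, Γ.tfun_zero⟩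

/-- `t(σ(τ)) = τ` on `J`. [folklore] -/
theorem tfun_σ {τ : ℝ} (hτ : τ ∈ Γ.J) : Γ.tfun (Γ.σ τ) = τ := invFun_eq hτ

/-- `σ(t(s)) = s`. [folklore] -/
theorem σ_tfun (s : ℝ) : Γ.σ (Γ.tfun s) = s :=
  StrictMonoInverse.invFun_apply Γ.hasDerivAt_tfun Γ.time_pos s

/-- `σ(0) = 0`. [folklore] -/
theorem σ_zero : Γ.σ 0 = 0 := by
  have h := Γ.σ_tfun 0
  rwa [Γ.tfun_zero] at h

/-- `t` is strictly increasing. [folklore] -/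
theorem strictMono_tfun : StrictMono Γ.tfun := StrictMonoInverse.strictMono Γ.hasDerivAt_tfun Γ.time_pos

/-- **`σ̇(τ) = 1/γ̇⁰(σ(τ))`** on `J`. [folklore] -/
theorem hasDerivAt_σ {τ : ℝ} (hτ : τ ∈ Γ.J) : HasDerivAt Γ.σ (vel Γ.γ (Γ.σ τ) 0)⁻¹ τ :=
  StrictMonoInverse.hasDerivAt_invFun Γ.hasDerivAt_tfun Γ.time_pos hτ

/-- `σ` is `C^∞` on `J`. [folklore] -/
theorem contDiffOn_σ : ContDiffOn ℝ ∞ Γ.σ Γ.J :=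
  StrictMonoInverse.contDiffOn_invFun Γ.contDiff_tfun Γ.deriv_tfun_pos

/-! ### The data in Kerr–Schild time -/

/-- **`κ(τ) = γ̇⁰(σ(τ))`**, the `N`-energy `−g(N, γ̇)` of the geodesic at the leaf `Σ_τ`
(`N = −(dt*)♯`). [cite: Sbierski2015, §4 (the theorem)] -/
def κ (τ : ℝ) : ℝ := vel Γ.γ (Γ.σ τ) 0

/-- **The spatial curve** `c(τ)`, `γ(σ(τ)) = (τ, c(τ))`. [cite: Sbierski2015, §4 (`γ_τ`)] -/
def c (τ : ℝ) : E3 := E4.spatial (Γ.γ (Γ.σ τ) : E4)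

/-- **The momentum in Kerr–Schild time**, `P(τ) = p(σ(τ)) = γ̇♭`. [cite: Sbierski2015, §3 (arXiv (2.14))] -/
def P (τ : ℝ) (μ : Fin 4) : ℝ := momentum M a Γ.γ (Γ.σ τ) μ

/-- **The phase Hessian in Kerr–Schild time**, `M(τ) = M(σ(τ))`. [cite: Sbierski2015, §3 (arXiv §2.2, pp. 12–14)] -/
def Mm (τ : ℝ) (μ ν : Fin 4) : ℂ := phaseHessian Γ.geod Γ.time_pos (Γ.σ τ) μ ν

/-- `κ > 0`. [folklore] -/
theorem κ_pos (τ : ℝ) : 0 < Γ.κ τ := Γ.time_pos _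

/-- **`(τ, c(τ)) = γ(σ(τ))`** on `J`. [cite: Sbierski2015, §4 (`γ_τ = Im γ ∩ Σ_τ`)] -/
theorem ofTimeSpace_c {τ : ℝ} (hτ : τ ∈ Γ.J) : E4.ofTimeSpace τ (Γ.c τ) = (Γ.γ (Γ.σ τ) : E4) := by
  have h0 : (Γ.γ (Γ.σ τ) : E4) 0 = τ := Γ.tfun_σ hτ
  conv_rhs => rw [← E4.ofTimeSpace_time_spatial (Γ.γ (Γ.σ τ) : E4)]
  rw [E4.time_apply, h0]
  rfl

/-- The point `(τ, c(τ))` lies in the exterior. [folklore] -/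
theorem ofTimeSpace_c_mem {τ : ℝ} (hτ : τ ∈ Γ.J) :
    E4.ofTimeSpace τ (Γ.c τ) ∈ (Kerr.exterior M a : Set E4) := by
  rw [Γ.ofTimeSpace_c hτ]; exact (Γ.γ (Γ.σ τ)).2

/-! ### Smoothness on `J` -/

/-- Composition with `σ` of a smooth function of the parameter is smooth on `J`. [folklore] -/
theorem contDiffOn_comp_σ {F : Type*} [NormedAddCommGroup F] [NormedSpace ℝ F] {g : ℝ → F}
    (hg : ContDiff ℝ ∞ g) : ContDiffOn ℝ ∞ (fun τ ↦ g (Γ.σ τ)) Γ.J :=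
  hg.comp_contDiffOn Γ.contDiffOn_σ

/-- `κ` is `C^∞` on `J`. [folklore] -/
theorem contDiffOn_κ : ContDiffOn ℝ ∞ Γ.κ Γ.J := Γ.contDiffOn_comp_σ (contDiff_vel_apply Γ.geod 0)

/-- `c` is `C^∞` on `J`, componentwise. [folklore] -/
theorem contDiffOn_c (i : Fin 3) : ContDiffOn ℝ ∞ (fun τ ↦ Γ.c τ i) Γ.J := by
  have h : ContDiff ℝ ∞ fun s ↦ (Γ.γ s : E4) i.succ := contDiff_euclidean.1 (contDiff_pos Γ.geod) _
  exact Γ.contDiffOn_comp_σ h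

/-- `P` is `C^∞` on `J`, componentwise. [folklore] -/
theorem contDiffOn_P (μ : Fin 4) : ContDiffOn ℝ ∞ (fun τ ↦ Γ.P τ μ) Γ.J :=
  Γ.contDiffOn_comp_σ (contDiff_momentum Γ.geod μ)

/-- `M` is `C^∞` on `J`, entrywise. [folklore] -/
theorem contDiffOn_Mm (μ ν : Fin 4) : ContDiffOn ℝ ∞ (fun τ ↦ Γ.Mm τ μ ν) Γ.J :=
  Γ.contDiffOn_comp_σ (contDiff_phaseHessian Γ.geod Γ.time_pos μ ν)

/-! ### Derivatives in Kerr–Schild time: `d/dt = κ⁻¹ d/ds` -/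

section Derivatives

variable {τ : ℝ} (hτ : τ ∈ Γ.J)
include hτ

omit hτ in
/-- The components of `c`: `c_i(t) = γ^{i+1}(σ(t))`. [folklore] -/
theorem c_apply (t : ℝ) (i : Fin 3) : Γ.c t i = (Γ.γ (Γ.σ t) : E4) i.succ := rfl

/-- `ċ_i(τ) = γ̇^{i+1}/γ̇⁰` at `σ(τ)`. [folklore] -/
theorem hasDerivAt_c (i : Fin 3) :
    HasDerivAt (fun t ↦ (Γ.γ (Γ.σ t) : E4) i.succ) ((vel Γ.γ (Γ.σ τ) 0)⁻¹ • vel Γ.γ (Γ.σ τ) i.succ) τ := by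
  have hg : HasDerivAt (fun s ↦ (Γ.γ s : E4) i.succ) (vel Γ.γ (Γ.σ τ) i.succ) (Γ.σ τ) :=
    (EuclideanSpace.proj (𝕜 := ℝ) i.succ).hasFDerivAt.comp_hasDerivAt _ (hasDerivAt_pos Γ.geod _)
  exact hg.scomp τ (Γ.hasDerivAt_σ hτ)

/-- `cdot c τ i = γ̇^{i+1}/κ`. [folklore] -/
theorem cdot_eq (i : Fin 3) : cdot Γ.c τ i = (Γ.κ τ)⁻¹ * vel Γ.γ (Γ.σ τ) i.succ := by
  have hfun : (fun s ↦ Γ.c s i) = fun s ↦ (Γ.γ (Γ.σ s) : E4) i.succ := funext fun s ↦ Γ.c_apply s i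
  rw [cdot, hfun, (Γ.hasDerivAt_c hτ i).deriv, smul_eq_mul, κ]

/-- `xdot c τ μ = γ̇^μ/κ` (`xdot ⁰ = 1 = γ̇⁰/γ̇⁰`). [folklore] -/
theorem xdot_eq (μ : Fin 4) : xdot Γ.c τ μ = (Γ.κ τ)⁻¹ * vel Γ.γ (Γ.σ τ) μ := by
  refine Fin.cases ?_ (fun i ↦ ?_) μ
  · simp only [xdot, Fin.cases_zero, κ]
    rw [inv_mul_cancel₀ (Γ.time_pos _).ne']
  · simp only [xdot, Fin.cases_succ]
    exact Γ.cdot_eq hτ i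

/-- `Ṗ_μ(τ) = ṗ_μ/κ` with `ṗ = −∂H/∂x` (`momentumRHS`). [cite: Sbierski2015, §3 (arXiv §2.2, p. 12)] -/
theorem hasDerivAt_P (μ : Fin 4) :
    HasDerivAt (fun t ↦ Γ.P t μ)
      ((vel Γ.γ (Γ.σ τ) 0)⁻¹ • momentumRHS M a (Γ.γ (Γ.σ τ)) (momentum M a Γ.γ (Γ.σ τ)) μ) τ :=
  (hasDerivAt_momentum' Γ.geod (Γ.σ τ) μ).scomp τ (Γ.hasDerivAt_σ hτ)

/-- `pdot P τ μ = ṗ_μ/κ`. [folklore] -/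
theorem pdot_eq (μ : Fin 4) :
    pdot Γ.P τ μ = (Γ.κ τ)⁻¹ * momentumRHS M a (Γ.γ (Γ.σ τ)) (momentum M a Γ.γ (Γ.σ τ)) μ := by
  rw [pdot, (Γ.hasDerivAt_P hτ μ).deriv, smul_eq_mul, κ]

/-- `Ṁ_{μν}(τ) = (dM/ds)_{μν}/κ` with the Riccati right-hand side. [cite: Sbierski2015, §3 (arXiv (2.23))] -/
theorem hasDerivAt_Mm (μ ν : Fin 4) :
    HasDerivAt (fun t ↦ Γ.Mm t μ ν)
      (((vel Γ.γ (Γ.σ τ) 0)⁻¹ : ℝ) • ((-jacobiAC M a Γ.γ (Γ.σ τ) -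
        jacobiBC M a Γ.γ (Γ.σ τ) * phaseHessian Γ.geod Γ.time_pos (Γ.σ τ) -
        phaseHessian Γ.geod Γ.time_pos (Γ.σ τ) * (jacobiBC M a Γ.γ (Γ.σ τ))ᵀ -
        phaseHessian Γ.geod Γ.time_pos (Γ.σ τ) * jacobiCC M a Γ.γ (Γ.σ τ) *
          phaseHessian Γ.geod Γ.time_pos (Γ.σ τ)) μ ν)) τ :=
  (hasDerivAt_phaseHessian Γ.geod Γ.time_pos (Γ.σ τ) μ ν).scomp τ (Γ.hasDerivAt_σ hτ)

/-- `κ · mdot M τ = (dM/ds)(σ τ)` entrywise. [folklore] -/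
theorem κ_mul_mdot (μ ν : Fin 4) :
    (Γ.κ τ : ℂ) * mdot Γ.Mm τ μ ν =
      (-jacobiAC M a Γ.γ (Γ.σ τ) - jacobiBC M a Γ.γ (Γ.σ τ) * phaseHessian Γ.geod Γ.time_pos (Γ.σ τ) -
        phaseHessian Γ.geod Γ.time_pos (Γ.σ τ) * (jacobiBC M a Γ.γ (Γ.σ τ))ᵀ -
        phaseHessian Γ.geod Γ.time_pos (Γ.σ τ) * jacobiCC M a Γ.γ (Γ.σ τ) *
          phaseHessian Γ.geod Γ.time_pos (Γ.σ τ)) μ ν := by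
  rw [mdot, (Γ.hasDerivAt_Mm hτ μ ν).deriv, κ, Complex.real_smul, ← mul_assoc, ← Complex.ofReal_mul,
    mul_inv_cancel₀ (Γ.time_pos _).ne', Complex.ofReal_one, one_mul]

end Derivatives

/-! ### The identities of the beam data -/

section Identities

variable {τ : ℝ} (hτ : τ ∈ Γ.J)
include hτ

/-- `P · Ẋ = 0` (null momentum, `Ẋ = γ̇/κ`). [cite: Sbierski2015, §3 (arXiv (2.14))] -/
theorem hPX : Γ.P τ 0 + ∑ i : Fin 3, Γ.P τ i.succ * cdot Γ.c τ i = 0 := by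
  have hnull := sum_vel_mul_momentum (Γ.null (Γ.σ τ))
  rw [Fin.sum_univ_succ] at hnull
  have hκ : vel Γ.γ (Γ.σ τ) 0 ≠ 0 := (Γ.time_pos _).ne'
  have hsum : Γ.P τ 0 + ∑ i : Fin 3, Γ.P τ i.succ * cdot Γ.c τ i =
      (vel Γ.γ (Γ.σ τ) 0)⁻¹ * (vel Γ.γ (Γ.σ τ) 0 * momentum M a Γ.γ (Γ.σ τ) 0 +
        ∑ i : Fin 3, vel Γ.γ (Γ.σ τ) i.succ * momentum M a Γ.γ (Γ.σ τ) i.succ) := by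
    simp only [Γ.cdot_eq hτ, P, κ]
    rw [mul_add, Finset.mul_sum, ← mul_assoc, inv_mul_cancel₀ hκ, one_mul]
    congr 1
    exact Finset.sum_congr rfl fun i _ ↦ by ring
  rw [hsum, hnull, mul_zero]

omit hτ in
/-- `M` is symmetric. [cite: Sbierski2015, §3 (arXiv §2.2, p. 14)] -/
theorem hsymm (μ ν : Fin 4) : Γ.Mm τ μ ν = Γ.Mm τ ν μ := by
  have h := phaseHessian_transpose Γ.geod Γ.time_pos (Γ.σ τ)
  have := congrFun (congrFun h ν) μ
  rw [Matrix.transpose_apply] at this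
  exact this

/-- `M Ẋ = Ṗ` (from `M γ̇ = ṗ`). [cite: Sbierski2015, §3 (arXiv (2.21))] -/
theorem hMX (μ : Fin 4) : ∑ ν : Fin 4, Γ.Mm τ μ ν * (xdot Γ.c τ ν : ℂ) = (pdot Γ.P τ μ : ℂ) := by
  have h := congrFun (phaseHessian_mulVec Γ.geod Γ.time_pos (Γ.σ τ)) μ
  simp only [Matrix.mulVec, dotProduct, velC, momentumRHSC] at h
  have hx : ∀ ν, (xdot Γ.c τ ν : ℂ) = ((Γ.κ τ)⁻¹ : ℝ) * (vel Γ.γ (Γ.σ τ) ν : ℂ) := fun ν ↦ by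
    rw [Γ.xdot_eq hτ ν]; push_cast; ring
  have hp : (pdot Γ.P τ μ : ℂ) =
      ((Γ.κ τ)⁻¹ : ℝ) * (momentumRHS M a (Γ.γ (Γ.σ τ)) (momentum M a Γ.γ (Γ.σ τ)) μ : ℂ) := by
    rw [Γ.pdot_eq hτ μ]; push_cast; ring
  simp only [hx, hp, Mm]
  calc ∑ ν, phaseHessian Γ.geod Γ.time_pos (Γ.σ τ) μ ν * ((((Γ.κ τ)⁻¹ : ℝ) : ℂ) * (vel Γ.γ (Γ.σ τ) ν : ℂ))
      = (((Γ.κ τ)⁻¹ : ℝ) : ℂ) * ∑ ν, phaseHessian Γ.geod Γ.time_pos (Γ.σ τ) μ ν * (vel Γ.γ (Γ.σ τ) ν : ℂ) := by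
        rw [Finset.mul_sum]; exact Finset.sum_congr rfl fun ν _ ↦ by ring
    _ = (((Γ.κ τ)⁻¹ : ℝ) : ℂ) * (momentumRHS M a (Γ.γ (Γ.σ τ)) (momentum M a Γ.γ (Γ.σ τ)) μ : ℂ) := by
        rw [h]

/-- `g^{μν} P_ν = κ Ẋ^μ` (raising the index: `γ̇ = g⁻¹ p`). [cite: Sbierski2015, §3 (arXiv §2.2, p. 12)] -/
theorem hvel (μ : Fin 4) :
    ∑ ν : Fin 4, Kerr.inverseMetric M a (E4.ofTimeSpace τ (Γ.c τ)) μ ν * Γ.P τ ν = Γ.κ τ * xdot Γ.c τ μ := by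
  rw [Γ.ofTimeSpace_c hτ, Γ.xdot_eq hτ, ← mul_assoc, mul_inv_cancel₀ (Γ.κ_pos τ).ne', one_mul]
  exact (vel_eq_sum Γ.γ (Γ.σ τ) μ).symm

/-- `∂_α g⁻¹(P, P) = −2κ Ṗ_α` (Hamilton's equation `ṗ = −∂H/∂x`). [cite: Sbierski2015, §3 (arXiv §2.2, p. 12)] -/
theorem hbichar (α : Fin 4) :
    ∑ μ : Fin 4, ∑ ν : Fin 4, dG (Kerr.inverseMetric M a) (E4.ofTimeSpace τ (Γ.c τ)) α μ ν * Γ.P τ μ * Γ.P τ ν =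
      -2 * Γ.κ τ * pdot Γ.P τ α := by
  rw [Γ.ofTimeSpace_c hτ, Γ.pdot_eq hτ, momentumRHS]
  have hκ : Γ.κ τ ≠ 0 := (Γ.κ_pos τ).ne'
  have hd : ∀ μ ν, dG (Kerr.inverseMetric M a) (Γ.γ (Γ.σ τ) : E4) α μ ν =
      dInv M a (Γ.γ (Γ.σ τ) : E4) α μ ν := fun μ ν ↦ rfl
  simp only [hd, P]
  field_simp

/-- `g⁻¹(P, P) = 0`. [cite: Sbierski2015, §3 (arXiv (2.14))] -/
theorem hnull' :
    ∑ μ : Fin 4, ∑ ν : Fin 4, Kerr.inverseMetric M a (E4.ofTimeSpace τ (Γ.c τ)) μ ν * Γ.P τ μ * Γ.P τ ν = 0 := by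
  have h := sum_vel_mul_momentum (Γ.null (Γ.σ τ))
  have hPm : ∀ ν, Γ.P τ ν = momentum M a Γ.γ (Γ.σ τ) ν := fun ν ↦ rfl
  rw [Γ.ofTimeSpace_c hτ]
  simp only [hPm]
  calc ∑ μ, ∑ ν, Kerr.inverseMetric M a (Γ.γ (Γ.σ τ) : E4) μ ν * momentum M a Γ.γ (Γ.σ τ) μ *
        momentum M a Γ.γ (Γ.σ τ) ν
      = ∑ μ, momentum M a Γ.γ (Γ.σ τ) μ *
          ∑ ν, Kerr.inverseMetric M a (Γ.γ (Γ.σ τ) : E4) μ ν * momentum M a Γ.γ (Γ.σ τ) ν := by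
        refine Finset.sum_congr rfl fun μ _ ↦ ?_
        rw [Finset.mul_sum]; exact Finset.sum_congr rfl fun ν _ ↦ by ring
    _ = ∑ μ, momentum M a Γ.γ (Γ.σ τ) μ * vel Γ.γ (Γ.σ τ) μ := by
        refine Finset.sum_congr rfl fun μ _ ↦ ?_
        rw [← vel_eq_sum Γ.γ (Γ.σ τ) μ]
    _ = 0 := by
        rw [← h]; exact Finset.sum_congr rfl fun μ _ ↦ by ring

/-- **The Riccati equation in Kerr–Schild time**:
`κ Ṁ = −(A + BM + MBᵀ + M g⁻¹ M)` with `A = ½ ∂∂g⁻¹(P,P)`, `B = ∂g⁻¹(P, ·)`.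
[cite: Sbierski2015, §3 (arXiv (2.23))] -/
theorem hRic (μ ν : Fin 4) :
    (Γ.κ τ : ℂ) * mdot Γ.Mm τ μ ν =
      -(2⁻¹ * (riccatiA2 (ddG (Kerr.inverseMetric M a) (E4.ofTimeSpace τ (Γ.c τ))) (Γ.P τ) μ ν : ℂ) +
        ∑ ρ : Fin 4, ((riccatiB (dG (Kerr.inverseMetric M a) (E4.ofTimeSpace τ (Γ.c τ))) (Γ.P τ) μ ρ : ℂ) *
            Γ.Mm τ ρ ν +
          Γ.Mm τ μ ρ * (riccatiB (dG (Kerr.inverseMetric M a) (E4.ofTimeSpace τ (Γ.c τ))) (Γ.P τ) ν ρ : ℂ)) +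
        ∑ ρ : Fin 4, ∑ σ' : Fin 4, Γ.Mm τ μ ρ *
          (Kerr.inverseMetric M a (E4.ofTimeSpace τ (Γ.c τ)) ρ σ' : ℂ) * Γ.Mm τ σ' ν) := by
  rw [Γ.κ_mul_mdot hτ μ ν, Γ.ofTimeSpace_c hτ]
  set x : E4 := (Γ.γ (Γ.σ τ) : E4) with hx
  set p : Fin 4 → ℝ := momentum M a Γ.γ (Γ.σ τ) with hp
  set N : Matrix (Fin 4) (Fin 4) ℂ := phaseHessian Γ.geod Γ.time_pos (Γ.σ τ) with hN
  have hxr : 0 < Kerr.radius a x := Kerr.radius_pos_of_mem_region (Γ.γ (Γ.σ τ)).2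
  -- the `A`-term: `½ riccatiA2 = Aᵀ = A`
  have hA : (2⁻¹ * (riccatiA2 (ddG (Kerr.inverseMetric M a) x) (Γ.P τ) μ ν : ℂ)) =
      jacobiAC M a Γ.γ (Γ.σ τ) μ ν := by
    have hAt : jacobiA M a x p μ ν = jacobiA M a x p ν μ := by
      have h := jacobiA_transpose (M := M) hxr p
      have := congrFun (congrFun h μ) ν
      rw [Matrix.transpose_apply] at this
      exact this.symm
    rw [jacobiAC, Matrix.map_apply, ← hp, ← hx, hAt, jacobiA_apply]
    have hdd : ∀ α β, ddG (Kerr.inverseMetric M a) x μ ν α β = ddInv M a x ν μ α β := fun α β ↦ rfl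
    simp only [riccatiA2, hdd, P, ← hp]
    push_cast
    ring
  have hB : ∀ i k, (riccatiB (dG (Kerr.inverseMetric M a) x) (Γ.P τ) i k : ℂ) = jacobiBC M a Γ.γ (Γ.σ τ) i k := by
    intro i k
    rw [jacobiBC, Matrix.map_apply, ← hp, ← hx, jacobiB_apply]
    have hd : ∀ ν', dG (Kerr.inverseMetric M a) x i k ν' = dInv M a x i k ν' := fun ν' ↦ rfl
    simp only [riccatiB, hd, P, ← hp, Complex.ofReal_sum, Complex.ofReal_mul]
  have hC : ∀ i k, (Kerr.inverseMetric M a x i k : ℂ) = jacobiCC M a Γ.γ (Γ.σ τ) i k := by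
    intro i k
    rw [jacobiCC, Matrix.map_apply, ← hx, jacobiC_apply]
  have hM : ∀ i k, Γ.Mm τ i k = N i k := fun i k ↦ rfl
  simp only [hA, hB, hC, hM, Matrix.sub_apply, Matrix.neg_apply, Matrix.mul_apply,
    Matrix.transpose_apply, Finset.sum_add_distrib]
  have hMCM : ∑ ρ, ∑ σ', N μ ρ * jacobiCC M a Γ.γ (Γ.σ τ) ρ σ' * N σ' ν =
      ∑ σ', (∑ ρ, N μ ρ * jacobiCC M a Γ.γ (Γ.σ τ) ρ σ') * N σ' ν := by
    rw [Finset.sum_comm]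
    exact Finset.sum_congr rfl fun σ' _ ↦ by rw [Finset.sum_mul]
  rw [hMCM]
  ring

omit hτ in
/-- **Transversal positivity of `Im M`** on the leaves. [cite: Sbierski2015, §3 (arXiv (2.12))] -/
theorem hIm (d : E3) (hd : d ≠ 0) :
    0 < ∑ i : Fin 3, ∑ j : Fin 3, (Γ.Mm τ i.succ j.succ).im * d i * d j := by
  have hd' : (fun i ↦ d i) ≠ 0 := by
    intro h
    apply hd
    ext i
    exact congrFun h i
  have h := imBlockForm_pos Γ.geod Γ.time_pos (Γ.σ τ) hd'
  simpa [imBlockForm, Mm] using h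

end Identities

/-! ### The beam data -/

/-- **The beam data of the null geodesic in Kerr–Schild time** (coefficients
`G = Kerr.inverseMetric`, domain the exterior chart, interval `J = γ⁰(ℝ)`, curve
`X(t) = (t, c(t)) = γ(σ(t))`, energy `κ = γ̇⁰`, momentum `P = γ̇♭`, Hessian `M`), an instance of
the abstract data of `GaussianBeamData.lean`. [cite: Sbierski2015, §3 (arXiv §2.2), §4] -/
def beamData : BeamData (Kerr.inverseMetric M a) (Kerr.exterior M a : Set E4) Γ.J where
  P := Γ.P
  M := Γ.Mm
  c := Γ.c
  κ := Γ.κ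
  hV := (Kerr.exterior M a).isOpen
  hG μ ν := fun _ hx ↦
    (Kerr.contDiffAt_inverseMetric M a (Kerr.radius_pos_of_mem_region hx) μ ν).contDiffWithinAt
  hGsymm x μ ν := Kerr.inverseMetric_symm M a x μ ν
  hJ := Γ.isOpen_J
  hJc := Γ.ordConnected_J
  h0 := Γ.zero_mem_J
  hP := Γ.contDiffOn_P
  hM := Γ.contDiffOn_Mm
  hc := Γ.contDiffOn_c
  hκ := Γ.contDiffOn_κ
  hκpos t _ := Γ.κ_pos t
  hXV _ ht := Γ.ofTimeSpace_c_mem ht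
  hPX _ ht := Γ.hPX ht
  hsymm t _ := Γ.hsymm (τ := t)
  hMX _ ht := Γ.hMX ht
  hvel _ ht := Γ.hvel ht
  hbichar _ ht := Γ.hbichar ht
  hnull _ ht := Γ.hnull' ht
  hRic _ ht := Γ.hRic ht
  hIm t _ := Γ.hIm (τ := t)

/-- The momentum of the beam data is `P`. [folklore] -/
@[simp] theorem beamData_P : Γ.beamData.P = Γ.P := rfl

/-- The Hessian of the beam data is `M`. [folklore] -/
@[simp] theorem beamData_M : Γ.beamData.M = Γ.Mm := rfl

/-- The curve of the beam data is `c`. [folklore] -/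
@[simp] theorem beamData_c : Γ.beamData.c = Γ.c := rfl

/-- The energy of the beam data is `κ`. [folklore] -/
@[simp] theorem beamData_κ : Γ.beamData.κ = Γ.κ := rfl

/-- **`X(τ) = γ(σ(τ))`.** [cite: Sbierski2015, §4 (`γ_τ`)] -/
theorem beamData_X {τ : ℝ} (hτ : τ ∈ Γ.J) : Γ.beamData.X τ = (Γ.γ (Γ.σ τ) : E4) :=
  Γ.ofTimeSpace_c hτ

end KerrNullGeodesic

end GaussianBeam

end Literature.Barriers.FinalStateConjecture
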